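import Summits.AtomisticToContinuum.HydrodynamicLimit.Theorems.BoxDissipativeWeakStrongFluxClosureDominatedInMeasure
import Summits.AtomisticToContinuum.HydrodynamicLimit.Theorems.BoxDissipativeWeakStrongFluxClosureOfParts
import Summits.AtomisticToContinuum.HydrodynamicLimit.Theorems.BoxDissipativeWeakStrongFluxClosureCollisionalVirialTight
import HarnessLib

/-!
# Crux `FluxClosure` (stmt-AtomisticToContinuum-9902, route BoxDissipativeWeakStrong), line `registered`:
# the momentum-balance defect converges in `L¹(P_N)` as soon as it converges in `P_N`-probability

Support file (`--supports stmt-AtomisticToContinuum-9902`, wave-2 format lemma W2e `fluxClosure_of_inProbability`).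
The crux asserts that the pathwise box momentum-balance DEFECT `D_N` of the hard-sphere box fields (cube kernel at
window `ℓ_N`) tends to `0` in `L¹(P_N)`, `P_N` the local Gibbs law transported by the flow. Sibling routes state the
same physics in `P_N`-probability. This file proves the upgrade "in `P_N`-probability ⇒ in `L¹(P_N)`" for `D_N`
itself, given `0 ≤ σ`, `0 ≤ η₁`, `|Z| ≤ Z_max` on `[0, η₁]`, probability laws, a uniform bound `C₂` on the second
moment of the kinetic energy per particle `e_N(z) = (N+1)⁻¹ Σ_a ‖v_a‖²` and a.e.-measurability of `D_N`:

* the landed pathwise dominations `FluxClosureVT.abs_boundary_le` (`|∫⟪m̂(t), w(t)⟫| ≤ W₀ (1 + e_N)/2` at `t = 0, τ`)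
  and `FluxClosureVT.abs_interior_le` (`|∫_0^τ∫ (⟪m̂, ∂ₜw⟫ + (m̂⊗m̂/ρ̂):∇w + p_cut div w)| ≤ τ (W₁ (1 + e_N)/2 +
  (9 + Z_max) C e_N)`) give `|D_N z| ≤ B (1 + e_N z)` on the good set, `B = W₀ + τ W₁ / 2 + τ C (9 + Z_max)`, the
  constants `W₀, W₁, C` bounding `w, ∂ₜw, ∇w` on `[0, τ] × 𝕋³` (compactness, `FluxClosureB4.exists_measurable_fderiv`,
  `FluxClosureK.exists_forall_abs_partialDeriv_le_slab`);
* `P_N`-a.e. datum is good (`EntropyClockDock.ae_mem_good_localGibbsLaw`);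
* the abstract uniform-integrability lemma `FluxClosureUI.tendsto_lintegral_abs_of_dominated_inMeasure`
  (ε-splitting and Cauchy–Schwarz on `{|D_N| > ε}`) concludes.

No definitions, no collision estimate. References: H. Spohn, *Large Scale Dynamics of Interacting Particles* (1991),
Part I §3.2–3.3.
-/

noncomputable section

namespace Summit.AtomisticToContinuum.HydrodynamicLimit.Theorems.FluxClosureFmt.W2e

open scoped BigOperators Topology Classical MeasureTheory ProbabilityTheory InnerProductSpace ENNReal
open Filter Set Function MeasureTheory
open Literature.MathematicalPhysics.KineticTheory Literature.Analysis.FluidPDE Literature.Analysis.FunctionSpaces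
open Summit.AtomisticToContinuum.HydrodynamicLimit.Theses.BoxDissipativeWeakStrong
open Summit.AtomisticToContinuum.HydrodynamicLimit.Theorems.EntropyClockDock (ae_mem_good_localGibbsLaw)

/-- **The momentum-balance defect: in `P_N`-probability ⇒ in `L¹(P_N)`** (wave-2 format lemma W2e of crux
`FluxClosure`). In the crux's vocabulary (cube kernel `K`, box fields `Dn, Mm, En`, box temperature `Th`, cut
compressibility `Zc`, cut pressure `Pc`): for `0 ≤ σ`, `0 ≤ η₁`, `0 ≤ C₂`, `|Z| ≤ Z_max` on `[0, η₁]`, local Gibbs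
laws `P_N` that are probability measures with `∫⁻ ofReal (e_N²) dP_N ≤ ofReal C₂`, every window `0 < ℓ_N ≤ 1`,
`τ ∈ [0, T)`, `w` smooth on `[0, T) × 𝕋³` with `D_N` a.e.-measurable under `P_N`: if `P_N {δ < |D_N|} → 0` for every
`δ > 0` then `∫⁻ |D_N| dP_N → 0`. Proof: `|D_N| ≤ B (1 + e_N)` on the good set (`FluxClosureVT.abs_boundary_le` at
`t = τ, 0`, `FluxClosureVT.abs_interior_le`, constants from compactness), good set `P_N`-conull, and
`FluxClosureUI.tendsto_lintegral_abs_of_dominated_inMeasure`. [folklore] -/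
theorem fluxClosure_of_inProbability : ∀ (σ η₁ : ℝ) (a₀ θ₀ : T3 → ℝ) (u₀ : T3 → V3) (C₂ Zmax T : ℝ) (Φ : (N : ℕ) → HardSphereFlow (Torus.geometry (Fin 3)) (hsDiameter σ N) (N + 1)) (ℓ : ℕ → ℝ), (∀ N, 0 < ℓ N ∧ ℓ N ≤ 1) → 0 ≤ σ → 0 ≤ η₁ → 0 ≤ C₂ → (∀ η ∈ Icc 0 η₁, |hsCompressibility η| ≤ Zmax) → (∀ N, IsProbabilityMeasure (localGibbsLaw σ a₀ u₀ θ₀ N (Φ N))) → (∀ N, ∫⁻ z, ENNReal.ofReal (((((N + 1 : ℕ) : ℝ))⁻¹ * ∑ a, ‖(z a).2‖ ^ 2) ^ 2) ∂(localGibbsLaw σ a₀ u₀ θ₀ N (Φ N)) ≤ ENNReal.ofReal C₂) → let K := fun (l : ℝ) (x y : T3) => indicator {y' : T3 | ∀ i, ‖y' i - x i‖ < l / 2} (fun _ => (l ^ 3)⁻¹) y; let Dn := fun N t z x => empiricalDensityField ((Φ N).flow t z) (K (ℓ N) x); let Mm := fun N t z x => empiricalMomentumField ((Φ N).flow t z)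 (K (ℓ N) x); let En := fun N t z x => empiricalEnergyField ((Φ N).flow t z) (K (ℓ N) x); let Th := fun (r : ℝ) (m : V3) (E : ℝ) => 2 / 3 * (E / r - ‖m‖ ^ 2 / (2 * r ^ 2)); let Zc := fun η : ℝ => hsCompressibility (min η η₁); let Pc := fun r ϑ : ℝ => r * ϑ * Zc (r * σ ^ 3); ∀ τ ∈ Ico 0 T, ∀ w : ℝ → T3 → V3, Torus.IsSmoothSpaceTimeOn (Ico 0 T) w → (∀ N, AEMeasurable (fun z : Config (N + 1) (Fin 3) T3 => (∫ x, inner ℝ (Mm N τ z x) (w τ x)) - (∫ x, inner ℝ (Mm N 0 z x) (w 0 x)) - ∫ t in Ioc 0 τ, ∫ x, (inner ℝ (Mm N t z x) (Torus.timeDerivWithin (Ico 0 T) w t x) + (∑ i, ∑ j, Mm N t z x i * Mm N t z x j / Dn N t z x * Torus.partialDeriv j (fun y => w t y i) x) + Pc (Dn N t z x) (Th (Dn N t z x) (Mm N t z x) (En N t z x)) * Torus.divergence (w t) x)) (localGibbsLaw σ a₀ u₀ θ₀ N (Φ N))) → (∀ δ : ℝ, 0 < δ → Tendsto (fun N : ℕ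 => localGibbsLaw σ a₀ u₀ θ₀ N (Φ N) {z | δ < |(∫ x, inner ℝ (Mm N τ z x) (w τ x)) - (∫ x, inner ℝ (Mm N 0 z x) (w 0 x)) - ∫ t in Ioc 0 τ, ∫ x, (inner ℝ (Mm N t z x) (Torus.timeDerivWithin (Ico 0 T) w t x) + (∑ i, ∑ j, Mm N t z x i * Mm N t z x j / Dn N t z x * Torus.partialDeriv j (fun y => w t y i) x) + Pc (Dn N t z x) (Th (Dn N t z x) (Mm N t z x) (En N t z x)) * Torus.divergence (w t) x)|}) atTop (𝓝 0)) → Tendsto (fun N : ℕ => ∫⁻ z, ENNReal.ofReal (|(∫ x, inner ℝ (Mm N τ z x) (w τ x)) - (∫ x, inner ℝ (Mm N 0 z x) (w 0 x)) - ∫ t in Ioc 0 τ, ∫ x, (inner ℝ (Mm N t z x) (Torus.timeDerivWithin (Ico 0 T) w t x) + (∑ i, ∑ j, Mm N t z x i * Mm N t z x j / Dn N t z x * Torus.partialDeriv j (fun y => w t y i) x) + Pc (Dn N t z x) (Th (Dn N t z x) (Mm N t z x) (En N t z x)) * Torus.divergence (w t) x)|) ∂(localGibbsLaw σ a₀ u₀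 θ₀ N (Φ N))) atTop (𝓝 0) := by
  intro σ η₁ a₀ θ₀ u₀ C₂ Zmax T Φ ℓ hℓ hσ hη₁ hC₂ hZ hP hE2
  dsimp only
  intro τ hτ w hw hDm hDp
  have hτ0 : 0 ≤ τ := hτ.1
  have hτT : τ < T := hτ.2
  -- bounds for `w`, `∂ₜw`, `∇w` on `[0, τ] × 𝕋³`
  obtain ⟨C, hC0, hC⟩ := FluxClosureK.exists_forall_abs_partialDeriv_le_slab hτT hw
  obtain ⟨W, hW⟩ := hw.exists_norm_le_of_isCompact isCompact_Icc (Icc_subset_Ico_right hτT)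
  obtain ⟨H, C₁, -, hHt, -, hHb⟩ := FluxClosureB4.exists_measurable_fderiv hτT hw
  have hW0 : 0 ≤ max W 0 := le_max_right _ _
  have hW₁0 : 0 ≤ max C₁ 0 := le_max_right _ _
  have hWt : ∀ t ∈ Icc 0 τ, ∀ x, ‖w t x‖ ≤ max W 0 := fun t ht x => (hW t ht x).trans (le_max_left _ _)
  have hDt : ∀ t ∈ Ioc 0 τ, ∀ x, ‖Torus.timeDerivWithin (Ico 0 T) w t x‖ ≤ max C₁ 0 := by
    intro t ht x
    have htT : t ∈ Ico 0 T := ⟨ht.1.le, lt_of_le_of_lt ht.2 hτT⟩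
    rw [hHt t htT x]
    calc ‖H (t, x) (1, 0)‖ ≤ ‖H (t, x)‖ * ‖((1 : ℝ), (0 : EuclideanSpace ℝ (Fin 3)))‖ :=
          ContinuousLinearMap.le_opNorm _ _
      _ ≤ C₁ * 1 := by
          refine mul_le_mul (hHb t ⟨ht.1.le, ht.2⟩ x) ?_ (norm_nonneg _)
            ((norm_nonneg _).trans (hHb t ⟨ht.1.le, ht.2⟩ x))
          rw [Prod.norm_def, norm_one, norm_zero, max_eq_left zero_le_one]
      _ ≤ max C₁ 0 := by rw [mul_one]; exact le_max_left _ _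
  have hZ0 : 0 ≤ Zmax := (abs_nonneg _).trans (hZ 0 ⟨le_rfl, hη₁⟩)
  have h9Z : (0 : ℝ) ≤ 9 + Zmax := by linarith
  set Bc : ℝ := max W 0 + τ * max C₁ 0 / 2 + τ * C * (9 + Zmax) with hBc
  have hBc0 : 0 ≤ Bc := by positivity
  -- the two landed pathwise dominations, in the crux's vocabulary
  have hB := FluxClosureVT.abs_boundary_le (fun N => hsDiameter σ N) Φ ℓ hℓ
  dsimp only at hB
  have hI := FluxClosureVT.abs_interior_le σ η₁ T Φ ℓ hℓ hσ hη₁ Zmax hZ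
  dsimp only at hI
  -- the kinetic energy per particle is measurable and nonnegative
  have hEm : ∀ N : ℕ, Measurable fun z : Config (N + 1) (Fin 3) T3 =>
      (((N + 1 : ℕ) : ℝ))⁻¹ * ∑ a, ‖(z a).2‖ ^ 2 := fun N =>
    measurable_const.mul (Finset.measurable_sum _ fun i _ => ((measurable_pi_apply i).snd).norm.pow_const 2)
  haveI : ∀ N, IsProbabilityMeasure (localGibbsLaw σ a₀ u₀ θ₀ N (Φ N)) := hP
  refine FluxClosureUI.tendsto_lintegral_abs_of_dominated_inMeasure
    (fun N => localGibbsLaw σ a₀ u₀ θ₀ N (Φ N)) _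
    (fun N (z : Config (N + 1) (Fin 3) T3) => (((N + 1 : ℕ) : ℝ))⁻¹ * ∑ a, ‖(z a).2‖ ^ 2)
    Bc C₂ hBc0 hC₂ hDm (fun N => (hEm N).aemeasurable) (fun N => ae_of_all _ fun z => by positivity)
    (fun N => ?_) hE2 hDp
  -- the pathwise domination on the good set (`P_N`-conull)
  filter_upwards [ae_mem_good_localGibbsLaw σ a₀ θ₀ u₀ N (Φ N)] with z hz
  have h1 := hB τ w (max W 0) hW0 hWt N z hz τ ⟨hτ0, le_rfl⟩
  have h2 := hB τ w (max W 0) hW0 hWt N z hz 0 ⟨le_rfl, hτ0⟩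
  have h3 := hI τ hτ w (max C₁ 0) C hW₁0 hDt hC N z hz
  have key : ∀ a b c : ℝ, |a - b - c| ≤ |a| + |b| + |c| := fun a b c => by
    have := abs_sub (a - b) c
    have := abs_sub a b
    linarith
  refine ((key _ _ _).trans (add_le_add (add_le_add h1 h2) h3)).trans ?_
  set E : ℝ := (((N + 1 : ℕ)) : ℝ)⁻¹ * ∑ a, ‖(z a).2‖ ^ 2 with hE
  have hE0 : 0 ≤ E := by positivity
  rw [hBc]
  nlinarith [mul_nonneg (mul_nonneg hτ0 hC0) h9Z, mul_nonneg hW₁0 hE0, mul_nonneg hτ0 (mul_nonneg hW₁0 hE0),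
    mul_nonneg (mul_nonneg (mul_nonneg hτ0 hC0) h9Z) hE0]

end Summit.AtomisticToContinuum.HydrodynamicLimit.Theorems.FluxClosureFmt.W2e

end
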